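import Summits.CriticalPhenomena.PercolationContinuityZ3.Theorems.Transplant.KNCells2RunInvO
import Summits.CriticalPhenomena.PercolationContinuityZ3.Theorems.Transplant.KNCells2RunInv
import Summits.CriticalPhenomena.PercolationContinuityZ3.Theorems.Transplant.KNCellsCoverO
import Summits.CriticalPhenomena.PercolationContinuityZ3.Theorems.Transplant.KNCellsCover
import Summits.CriticalPhenomena.PercolationContinuityZ3.Theorems.Transplant.KNCellsSchemeO
import Summits.CriticalPhenomena.PercolationContinuityZ3.Theorems.Transplant.KNCellsProcessO
import Summits.CriticalPhenomena.PercolationContinuityZ3.Theorems.Transplant.KNCellsRunO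
import Summits.CriticalPhenomena.PercolationContinuityZ3.Theorems.Transplant.KNCellsRunInvO
import Summits.CriticalPhenomena.PercolationContinuityZ3.Theorems.Transplant.KNCells2SchemeO
import Summits.CriticalPhenomena.PercolationContinuityZ3.Theorems.Transplant.KNCells2RunO
import Summits.CriticalPhenomena.PercolationContinuityZ3.Theorems.Transplant.KNCells2Cover
import Literature.Probability.Percolation.OrientedHistorySiteRenormalizationRun
import HarnessLib

/-!
# N2 (frames-only node `SamePDropOfSkeletonFrm₁`, OPEN) — ORIENTED MACRO LAYER (WAVE 0 (c1), (R-18) `q ≡ true`): the oriented twin of N1's `KNCells2Cover`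

builds on p205010 (kernel theorem, internal audit signed; external expert review pending) — nothing in this file uses p205010; NOTHING is claimed about the
open node `SamePDropOfSkeletonFrm₁` (`SamePDropOfSkeletonNeg₁` is CLOSED in the tree and untouched by this file).
Status sentence (coordinator 2026-08-20T04:30Z): "θ(p_c) = 0 on ℤ^d, all d ≥ 2 — kernel-verified (Lean 4/Mathlib, standard axioms); internal adversarial
audit SIGNED 2026-08-20 04:29Z; external expert review pending."
Lane `prim-bschramm-*`, seat `prim-bschramm-stmt` (gen 19); helper file (`--supports stmt-CriticalPhenomena-4575 --as helper`); N2-SCOPE §20, (R-18)/(R-19).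
PORT RULES (HOME/prim-bschramm-stmt-g19/lean/port_orient.py): the history-site API is replaced by its ORIENTED twin at the fixed quadrant `qNE := fun _ => true`
(`HState.choice ↦ HState.ochoice qNE`, `mstOf ↦ omstOf qNE`, `mst/stN ↦ omst/ostN qNE`, `occFinal ↦ ooccFinal qNE`, `Lawful ↦ OLawful qNE`, onward directions
`onward ↦ onwardO` = the POSITIVE ones, (N2-e)); every declaration whose text changes thereby — directly or through a changed declaration — is re-declared with the
suffix `O` (same namespace); unchanged declarations of the N1 file are NOT repeated (the N1 module is imported). Docstrings/citations are N1's.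
N1 HEADER (kept for the reader):
* `SepGeom₂` = `SepGeom` + the two CROSS-ANCHOR containments of the lag-1 scheme: `Q^α_x ⊆ Cell^β_x` and `Btw^α_{v,x} ⊆ Cell^α_v ∪ Cell^β_x`
  for `β` admissible for `α` (instance: fibre balls `B(α,2R) ⊆ B(β,3R)` for `β ∈ B(α,R)`);
* `root_mem_V₂`, `zero_mem_occ₂`, `newRegion_subset_V₂`, `det_tgt_of_probe₂`, `anchors_tgt_of_probe₂`, `anchors_src_of_probe₂`,
  **`V_subset_Cover₂`**, `det_of_col₂`, `col_of_det₂` ((29)), `mem_onward_of_not_det₂`, `probe_time_unique₂`, `newRegion_disjoint₂`,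
  `du_ne_rev₂`, **`mem_Stub_of_mem_V_of_mem_Efar₂`** ((31)), `not_mem_Ewv_root_of_mem_V₂`.
[cite: KozmaNitzan2024, §4 pp. 26–28 ((29), (31)) — the ℤ^d model] [cite: GrimmettPercolation1999, §7.2]
-/
noncomputable section

open MeasureTheory ProbabilityTheory
open scoped ENNReal Classical

namespace Summit.CriticalPhenomena.PercolationContinuityZ3.Theorems

namespace Transplant

namespace KNCells

open Literature.Probability.Percolation Literature.Probability.LatticeModels SimpleGraph GadgetSystem ProbeHistory HSiteScheme Contour

variable {V : Type*} [DecidableEq V]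

namespace KSchA

variable {A : Type*} {G : SimpleGraph V} [G.LocallyFinite] {S : KSchA V A}
variable (hΓ : RunGeom G S.Γ) (hA : AnchGeom S.Γ) (hsep : SepGeom₂ G S.Γ) {ω : BondConfig V}
include hΓ hA hsep

/-! ## §2 (29): the explored region and the determined macro-vertices -/

omit hA hsep in
/-- The root is explored. [folklore] -/
theorem root_mem_V₂O (hroot : S.Γ.root ∈ S.Γ.Q S.Γ.a₀ 0) (n : ℕ) : S.Γ.root ∈ S.Vx G (S.hst₂O G ω n) := by
  have h0 : S.Γ.root ∈ S.Vx G (S.hst₂O G ω 0) := by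
    show S.Γ.root ∈ S.Vx G []
    rw [S.V_nil hΓ]; exact hroot
  exact S.V_mono₂O ω (Nat.zero_le n) h0

omit hΓ hA hsep in
/-- The macro-origin is always occupied. [folklore] -/
theorem zero_mem_occ₂O (n : ℕ) : (0 : Site 2) ∈ ((S.scheme₂O G).ostN qNE n ω).occ :=
  ((S.scheme₂O G).inv_omst qNE _).zero_mem

omit hsep in
/-- The new region of a probe lies in the explored region afterwards. [cite: KozmaNitzan2024, §4 p. 27 (E_{i+1})] -/
theorem newRegion_subset_V₂O {m n : ℕ} (hmn : m < n) {e : Site 2 × MDir} (hc : ((S.scheme₂O G).ostN qNE m ω).ochoice qNE = some e)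
    (hD : (S.scheme₂O G).E.next (S.hst₂O G ω m) = some (S.probe₂O G (S.hst₂O G ω m) e (S.aOf₁O G (S.hst₂O G ω m) e) (S.aOf₂O G (S.hst₂O G ω m) e))) :
    S.newR₂O G ω (S.hst₂O G ω m) e ⊆ S.Vx G (S.hst₂O G ω n) := by
  have h1 := (V_step₂O hΓ (runInv₂O hΓ hA ω m) hc hD).2
  intro y hy
  refine S.V_mono₂O ω (Nat.succ_le_of_lt hmn) ?_
  show y ∈ S.Vx G (S.hst₂O G ω (m + 1))
  rw [h1]; exact Finset.mem_union_right _ hy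

omit hΓ hA hsep in
/-- The target of a probe is determined afterwards. [folklore] -/
theorem det_tgt_of_probe₂O {m n : ℕ} (hmn : m < n) {e : Site 2 × MDir} (hc : ((S.scheme₂O G).ostN qNE m ω).ochoice qNE = some e)
    (hD : (S.scheme₂O G).E.next (S.hst₂O G ω m) = some (S.probe₂O G (S.hst₂O G ω m) e (S.aOf₁O G (S.hst₂O G ω m) e) (S.aOf₂O G (S.hst₂O G ω m) e))) :
    ((S.scheme₂O G).ostN qNE n ω).Det (tgt e) := by
  have hstO := (S.step_some₂O hc hD).2.2.1
  refine (S.scheme₂O G).det_ostN_mono qNE ω (Nat.succ_le_of_lt hmn) ?_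
  rw [hstO]
  exact HState.det_update_tgt _ _ _

omit hΓ hA hsep in
/-- The anchors of the target of a probe, from the next step on: arrival = the source anchor, departure = the one read off the observation.
[folklore] -/
theorem anchors_tgt_of_probe₂O {m n : ℕ} (hmn : m < n) {e : Site 2 × MDir} (hc : ((S.scheme₂O G).ostN qNE m ω).ochoice qNE = some e)
    (hD : (S.scheme₂O G).E.next (S.hst₂O G ω m) = some (S.probe₂O G (S.hst₂O G ω m) e (S.aOf₁O G (S.hst₂O G ω m) e) (S.aOf₂O G (S.hst₂O G ω m) e))) :
    (S.astOf₂O G (S.hst₂O G ω n)).arr (tgt e) = S.aOf₂O G (S.hst₂O G ω m) e ∧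
      (S.astOf₂O G (S.hst₂O G ω n)).dep (tgt e) = S.dOf₂O G ω (S.hst₂O G ω m) e := by
  obtain ⟨-, -, hstO, harr, hdep⟩ := S.step_some₂O hc hD
  have hdet : ((S.scheme₂O G).ostN qNE (m + 1) ω).Det (tgt e) := by rw [hstO]; exact HState.det_update_tgt _ _ _
  obtain ⟨h1, h2⟩ := S.anchors_eq_of_det₂O hdet (n := n) (Nat.succ_le_of_lt hmn)
  rw [h1, h2, harr, hdep, Function.update_self, Function.update_self]
  exact ⟨rfl, rfl⟩

omit hΓ hA hsep in
/-- The anchors of the source of a probe do not change from the probe on (the source is occupied). [folklore] -/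
theorem anchors_src_of_probe₂O {m n : ℕ} (hmn : m ≤ n) {e : Site 2 × MDir} (hc : ((S.scheme₂O G).ostN qNE m ω).ochoice qNE = some e) :
    (S.astOf₂O G (S.hst₂O G ω n)).arr e.1 = (S.astOf₂O G (S.hst₂O G ω m)).arr e.1 ∧
      (S.astOf₂O G (S.hst₂O G ω n)).dep e.1 = (S.astOf₂O G (S.hst₂O G ω m)).dep e.1 :=
  S.anchors_eq_of_det₂O (Or.inl (HState.cand_of_ochoice hc).1) hmn

/-- **The explored region lies in the cover of the determined macro-vertices** (cells and zones both at the stored `arr` anchors: the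
cube `Q^α_x` lies in `Cell^β_x` by the cross-anchor containment). [cite: KozmaNitzan2024, §4 pp. 26–27 ((29), (31))] -/
theorem V_subset_Cover₂O (n : ℕ) :
    (↑(S.Vx G (S.hst₂O G ω n)) : Set V) ⊆
      S.Γ.Cover (S.astOf₂O G (S.hst₂O G ω n)).arr (S.astOf₂O G (S.hst₂O G ω n)).arr {x | ((S.scheme₂O G).ostN qNE n ω).Det x} := by
  intro y hy
  have hI := runInv₂O hΓ hA ω n
  simp only [CellGeom.Cover, Set.mem_iUnion, Set.mem_union, exists_prop, Finset.mem_coe, Set.mem_setOf_eq]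
  rcases hI.V_cases y (Finset.mem_coe.1 hy) with h | ⟨m, hm, e, hc, -, hD, h⟩
  · refine ⟨0, Or.inl (zero_mem_occ₂O n), Or.inl ?_⟩
    rw [hI.arr_zero]; exact hsep.Q_subset_Cell _ _ h
  · have hsrc : ((S.scheme₂O G).ostN qNE n ω).Det e.1 := Or.inl ((S.scheme₂O G).occ_ostN_mono qNE ω hm.le (HState.cand_of_ochoice hc).1)
    have htgt : ((S.scheme₂O G).ostN qNE n ω).Det (tgt e) := det_tgt_of_probe₂O hm hc hD
    obtain ⟨harrT, -⟩ := anchors_tgt_of_probe₂O (S := S) hm hc hD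
    obtain ⟨harrS, -⟩ := anchors_src_of_probe₂O (S := S) hm.le hc
    -- the stub anchor `β = dep_m e.1` is admissible for the region anchor `α = arr_m e.1`
    have hβ : S.aOf₂O G (S.hst₂O G ω m) e ∈ S.Γ.anchSet (S.aOf₁O G (S.hst₂O G ω m) e) (tgt e) := (runInv₂O hΓ hA ω m).anch e.1 (tgt e)
    rcases Finset.mem_union.1 h with h | h
    · rcases Finset.mem_union.1 h with h | h
      · -- `Btw^α` lies in `Cell^α (e.1) ∪ Cell^β (tgt e)`
        rcases Finset.mem_union.1 (hsep.Btw_subset_Cells₂ _ _ _ _ hβ h) with h | h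
        · exact ⟨e.1, hsrc, Or.inl (by rw [harrS]; exact h)⟩
        · exact ⟨tgt e, htgt, Or.inl (by rw [harrT]; exact h)⟩
      · exact ⟨tgt e, htgt, Or.inl (by rw [harrT]; exact hsep.Q_subset_Cell₂ _ _ _ hβ h)⟩
    · obtain ⟨du, -, h⟩ := Finset.mem_biUnion.1 h
      have hj : S.jOf G (S.hst₂O G ω m) e (S.aOf₁O G (S.hst₂O G ω m) e) (S.aOf₂O G (S.hst₂O G ω m) e) du (S.oOf₂O G ω (S.hst₂O G ω m) e) + 1 ≤ S.Γ.K :=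
        S.jOf_lt _ _ _ _ _ _
      rcases Finset.mem_union.1 (hsep.Stub_subset_Cell_union_Zone _ _ _ _ _ (hA.refl _ _) hj h) with h | h
      · exact ⟨tgt e, htgt, Or.inl (by rw [harrT]; exact h)⟩
      · exact ⟨tgt e, htgt, Or.inr ⟨du, by rw [harrT]; exact h⟩⟩

/-- **(29), converse half**: a macro-vertex whose column meets the explored region is determined. [cite: KozmaNitzan2024, §4 p. 26 ((29))] -/
theorem det_of_col₂O {n : ℕ} {x : Site 2} {y : V} (hyV : y ∈ S.Vx G (S.hst₂O G ω n)) (hyc : y ∈ S.Γ.col x) :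
    ((S.scheme₂O G).ostN qNE n ω).Det x := by
  have hy := V_subset_Cover₂O hΓ hA hsep n (Finset.mem_coe.2 hyV)
  simp only [CellGeom.Cover, Set.mem_iUnion, Set.mem_union, exists_prop, Finset.mem_coe, Set.mem_setOf_eq] at hy
  obtain ⟨u, hu, h | ⟨δ, h⟩⟩ := hy
  · by_contra hx
    have hux : u ≠ x := fun h' => hx (h' ▸ hu)
    exact hsep.col_Cell _ _ _ hux _ h hyc
  · exact absurd hyc (hsep.col_Zone _ _ _ _ _ h)

/-- **(29), direct half**: the column of a determined macro-vertex meets the explored region. [cite: KozmaNitzan2024, §4 p. 26 ((29))] -/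
theorem col_of_det₂O {n : ℕ} {x : Site 2} (hx : ((S.scheme₂O G).ostN qNE n ω).Det x) : ∃ y ∈ S.Vx G (S.hst₂O G ω n), y ∈ S.Γ.col x := by
  obtain ⟨a, ha⟩ := (runInv₂O hΓ hA ω n).det_Q x hx
  obtain ⟨y, hy, hyc⟩ := hsep.col_Q a x
  exact ⟨y, ha hy, hyc⟩

/-- An undetermined neighbour is an onward direction of every earlier history. [cite: KozmaNitzan2024, §4 p. 27 (X = X_v)] -/
theorem mem_onward_of_not_det₂O {m n : ℕ} (hmn : m ≤ n) {w : Site 2} {du : MDir}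
    (hv : ¬((S.scheme₂O G).ostN qNE n ω).Det (w + stepVec du)) : du ∈ S.onward G (S.hst₂O G ω m) w :=
  Finset.mem_filter.2 ⟨Finset.mem_univ _, fun _ hy hyc =>
    hv ((S.scheme₂O G).det_ostN_mono qNE ω hmn (det_of_col₂O hΓ hA hsep hy hyc))⟩

omit hΓ hA hsep in
/-- A probe's target is examined only once. [folklore] -/
theorem probe_time_unique₂O {m m' : ℕ} {e e' : Site 2 × MDir} (hc : ((S.scheme₂O G).ostN qNE m ω).ochoice qNE = some e)
    (hD : (S.scheme₂O G).E.next (S.hst₂O G ω m) = some (S.probe₂O G (S.hst₂O G ω m) e (S.aOf₁O G (S.hst₂O G ω m) e) (S.aOf₂O G (S.hst₂O G ω m) e)))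
    (hc' : ((S.scheme₂O G).ostN qNE m' ω).ochoice qNE = some e')
    (hD' : (S.scheme₂O G).E.next (S.hst₂O G ω m') = some (S.probe₂O G (S.hst₂O G ω m') e' (S.aOf₁O G (S.hst₂O G ω m') e') (S.aOf₂O G (S.hst₂O G ω m') e')))
    (ht : tgt e' = tgt e) : m' = m := by
  by_contra hne
  rcases lt_or_gt_of_ne hne with hlt | hlt
  · have h1 := det_tgt_of_probe₂O (S := S) hlt hc' hD'
    rw [ht] at h1
    exact (HState.cand_of_ochoice hc).2 h1
  · have h1 := det_tgt_of_probe₂O (S := S) hlt hc hD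
    rw [← ht] at h1
    exact (HState.cand_of_ochoice hc').2 h1

/-! ## §3 (31): nothing explored later meets `E_{v,x}` -/

omit hΓ in
/-- The new region of an examination along `e'` (any region / stub anchors) avoids `Btw(w, du) ∪ Q_{w+du}` (any anchors) whenever the target
of `e'` is neither `w` nor `w + du` and its source is not `w + du`. [cite: KozmaNitzan2024, §4 p. 27 ((31))] -/
theorem newRegion_disjoint₂O (h : ProbeHistory V) (e' : Site 2 × MDir) (a a' : A) (o : Finset (Sym2 V))
    {b b' : A} {w : Site 2} {du : MDir} (hv' : tgt e' ≠ w + stepVec du) (hv'w : tgt e' ≠ w) (hw' : e'.1 ≠ w + stepVec du)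
    {y : V} (hy : y ∈ S.newRegionO G h e' a a' o) : y ∉ S.Γ.Btw b w du ∧ y ∉ S.Γ.Q b' (w + stepVec du) := by
  have hQt : ∀ {c} {z}, z ∈ S.Γ.Q c (tgt e') → z ∉ S.Γ.Btw b w du ∧ z ∉ S.Γ.Q b' (w + stepVec du) := fun hz =>
    ⟨Finset.disjoint_left.1 (hsep.Q_disjoint_Btw _ _ (tgt e') w du) hz, Finset.disjoint_left.1 (hsep.Q_disjoint_Q _ _ _ _ hv') hz⟩
  rcases Finset.mem_union.1 hy with hy | hy
  · rcases Finset.mem_union.1 hy with hy | hy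
    · refine ⟨fun hy' => ?_, Finset.disjoint_right.1 (hsep.Q_disjoint_Btw _ _ (w + stepVec du) e'.1 e'.2) hy⟩
      refine Finset.disjoint_left.1 (hsep.Btw_disjoint_Btw b a w du e'.1 e'.2 ?_ ?_) hy' hy
      · intro heq
        apply hv'
        have h1 : e'.1 = w := congrArg Prod.fst heq
        have h2 : e'.2 = du := congrArg Prod.snd heq
        show e'.1 + stepVec e'.2 = w + stepVec du
        rw [h1, h2]
      · intro heq; exact hw' (congrArg Prod.fst heq)
    · exact hQt hy
  · obtain ⟨du'', -, hy⟩ := Finset.mem_biUnion.1 hy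
    rcases Finset.mem_union.1 (hsep.Stub_subset_Q_union_Btw _ _ _ _ _ (hA.refl _ _) (S.jOf_lt _ _ _ _ _ _) hy) with hy | hy
    · exact hQt hy
    · refine ⟨fun hy' => ?_, Finset.disjoint_right.1 (hsep.Q_disjoint_Btw _ _ (w + stepVec du) (tgt e') du'') hy⟩
      refine Finset.disjoint_left.1 (hsep.Btw_disjoint_Btw b a' w du (tgt e') du'' ?_ ?_) hy' hy
      · intro heq; exact hv'w (congrArg Prod.fst heq)
      · intro heq; exact hv' (congrArg Prod.fst heq)

omit hΓ hA hsep in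
/-- An onward direction of a valid examination does not point back at the source. [folklore] -/
theorem du_ne_rev₂O {h : ProbeHistory V} {e : Site 2 × MDir} (hV : S.Valid₂O G h e) {du : MDir} (hdu : du ∈ S.onwardO G h (tgt e)) :
    du ≠ rev e.2 := by
  intro hrev
  have h1 := (Finset.mem_filter.1 (Finset.mem_filter.1 hdu).1).2
  have h2 : tgt e + stepVec du = e.1 := by rw [hrev]; exact tgt_tgt_rev e
  rw [h2] at h1
  obtain ⟨y, hy, hyc⟩ := hV.src_mem
  exact h1 y hy hyc

/-- **(31)**: after the examination of `x = tgt e` at time `m` (stub anchor `β`), as long as `y = x + du` is undetermined, the explored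
region meets `E^β_{x,y}` only inside the stub `H^{j_y,β}_{x,y}` revealed at time `m`. [cite: KozmaNitzan2024, §4 p. 27 ((31))] -/
theorem mem_Stub_of_mem_V_of_mem_Efar₂O {n m : ℕ} (hm : m < n) {e : Site 2 × MDir}
    (hc : ((S.scheme₂O G).ostN qNE m ω).ochoice qNE = some e) (hV : S.Valid₂O G (S.hst₂O G ω m) e)
    (hD : (S.scheme₂O G).E.next (S.hst₂O G ω m) = some (S.probe₂O G (S.hst₂O G ω m) e (S.aOf₁O G (S.hst₂O G ω m) e) (S.aOf₂O G (S.hst₂O G ω m) e)))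
    {du : MDir} (hv : ¬((S.scheme₂O G).ostN qNE n ω).Det (tgt e + stepVec du)) (hfwd : du.2 = qNE du.1) {y : V} (hyV : y ∈ S.Vx G (S.hst₂O G ω n))
    (hyE : y ∈ S.Γ.Efar (S.aOf₂O G (S.hst₂O G ω m) e) (tgt e) du) :
    y ∈ S.Γ.Stub (S.aOf₂O G (S.hst₂O G ω m) e) (tgt e) du
      (S.jOf G (S.hst₂O G ω m) e (S.aOf₁O G (S.hst₂O G ω m) e) (S.aOf₂O G (S.hst₂O G ω m) e) du (S.oOf₂O G ω (S.hst₂O G ω m) e)) := by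
  have hdu : du ∈ S.onwardO G (S.hst₂O G ω m) (tgt e) := Finset.mem_filter.2 ⟨mem_onward_of_not_det₂O hΓ hA hsep hm.le hv, hfwd⟩
  have hv0 : tgt e + stepVec du ≠ 0 := fun h => hv (by rw [h]; exact Or.inl (zero_mem_occ₂O n))
  have hyE' := hsep.Efar_subset_Btw_union_Q _ _ _ hyE
  rcases (runInv₂O hΓ hA ω n).V_cases y hyV with hy0 | ⟨m', hm', e', hc', -, hD', hy'⟩
  · exfalso
    rcases Finset.mem_union.1 hyE' with h | h
    · exact Finset.disjoint_left.1 (hsep.Q_disjoint_Btw _ _ 0 (tgt e) du) hy0 h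
    · exact Finset.disjoint_left.1 (hsep.Q_disjoint_Q _ _ _ _ hv0.symm) hy0 h
  · by_cases hmm : m' = m
    · subst hmm
      rw [hc] at hc'
      cases Option.some_injective _ hc'
      rcases Finset.mem_union.1 hy' with hy' | hy'
      · exact absurd hyE (Finset.disjoint_left.1 (hsep.Ewv_disjoint_Efar _ _ e.1 e.2 du (du_ne_rev₂O hV hdu)) hy')
      · obtain ⟨du'', -, hy'⟩ := Finset.mem_biUnion.1 hy'
        by_cases hdd : du'' = du
        · subst hdd; exact hy'
        · exfalso
          rcases Finset.mem_union.1 (hsep.Stub_subset_Q_union_Btw _ _ _ _ _ (hA.refl _ _) (S.jOf_lt _ _ _ _ _ _) hy') with h | h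
          · exact Finset.disjoint_left.1 (hsep.Q_disjoint_Efar _ _ _ _) h hyE
          · exact Finset.disjoint_left.1 (hsep.Btw_disjoint_Efar _ _ _ _ _ hdd) h hyE
    · exfalso
      have hv' : tgt e' ≠ tgt e + stepVec du := fun h => hv (h ▸ det_tgt_of_probe₂O hm' hc' hD')
      have hv'w : tgt e' ≠ tgt e := fun h => hmm (probe_time_unique₂O hc hD hc' hD' h)
      have hw' : e'.1 ≠ tgt e + stepVec du := fun h =>
        hv (h ▸ Or.inl ((S.scheme₂O G).occ_ostN_mono qNE ω hm'.le (HState.cand_of_ochoice hc').1))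
      obtain ⟨h1, h2⟩ := newRegion_disjoint₂O hA hsep _ _ _ _ _ hv' hv'w hw' hy'
      rcases Finset.mem_union.1 hyE' with h | h
      · exact h1 h
      · exact h2 h

/-- **(31) at the root cell**: as long as `x = 0 + du` is undetermined, the explored region avoids `E_{0,x}` (any anchor).
[cite: KozmaNitzan2024, §4 p. 28 ((E₁ ∪ E_{w,v}) ∩ E_i = E₁)] -/
theorem not_mem_Ewv_root_of_mem_V₂O {n : ℕ} {du : MDir} (hv : ¬((S.scheme₂O G).ostN qNE n ω).Det ((0 : Site 2) + stepVec du))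
    {b : A} {y : V} (hyV : y ∈ S.Vx G (S.hst₂O G ω n)) : y ∉ S.Γ.Ewv b 0 du := by
  have hv0 : (0 : Site 2) + stepVec du ≠ 0 := fun h => hv (by rw [h]; exact Or.inl (zero_mem_occ₂O n))
  intro hyE
  rcases (runInv₂O hΓ hA ω n).V_cases y hyV with hy0 | ⟨m', hm', e', hc', -, hD', hy'⟩
  · rcases Finset.mem_union.1 hyE with h | h
    · exact Finset.disjoint_left.1 (hsep.Q_disjoint_Btw _ _ 0 0 du) hy0 h
    · exact Finset.disjoint_left.1 (hsep.Q_disjoint_Q _ _ _ _ hv0.symm) hy0 h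
  · have hv' : tgt e' ≠ 0 + stepVec du := fun h => hv (h ▸ det_tgt_of_probe₂O hm' hc' hD')
    have hv'w : tgt e' ≠ 0 := fun h => (HState.cand_of_ochoice hc').2 (h ▸ Or.inl (zero_mem_occ₂O m'))
    have hw' : e'.1 ≠ 0 + stepVec du := fun h =>
      hv (h ▸ Or.inl ((S.scheme₂O G).occ_ostN_mono qNE ω hm'.le (HState.cand_of_ochoice hc').1))
    obtain ⟨h1, h2⟩ := newRegion_disjoint₂O hA hsep _ _ _ _ _ hv' hv'w hw' hy'
    rcases Finset.mem_union.1 hyE with h | h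
    · exact h1 h
    · exact h2 h

end KSchA

end KNCells

end Transplant

end Summit.CriticalPhenomena.PercolationContinuityZ3.Theorems

end
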